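import Summits.BirchSwinnertonDyer.Rank1Residual.X4.OldShapeOfIhara
import HarnessLib

/-!
# The level-`M` character of an `ℓ`-old eigen-functional: a dichotomy (cell `b2b-bsdres`, seat additive-p4, line V45)

HONEST FRAMING (verbatim, cell `b2b-bsdres`): the goal of the cell is to DELETE the COMBINATION-SHAPED
residual classes for ALL analytic-rank `≤ 1` curves over `ℚ` — "full BSD formula for every rank `≤ 1`
curve in class `C`" assembled STRICTLY from published theorems — so that the rank-`≤ 1` remainder
becomes exactly the CONSTRUCTION-SHAPED classes, which are TYPED (missing-input Props), NOT attempted;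
this is not "finishing BSD". This file: TOOL theorems (algebra over the tree's period homology
`H₁(X₀(N), ℤ) = periodHomology N ⊆ S₂(Γ₀(N))^∨` and its prime-to-`Mℓ` Hecke ring
`𝕋̃ = HeckeRing0.primeTo M 2 (Mℓ)`), 0 defs, 0 facts, nothing booked; X4 CONSTRUCTION-SHAPED.

## Why (line V45 = the Mazur-principle route of V43 WITHOUT multiplicity one, kernel side)

Gen 24/25 reduced the corner's level-lowering certificate to the inclusion `E'[p] ⊆ B_ℓ` read on
cycles: the reduced plus functional `Φ` of `f` (level `Mℓ`, `θ(r) = a_r(f)`) is `ℓ`-OLD on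
`H₁(X₀(Mℓ), ℤ)`, `Φ = Λ₁∘α_* + Λ₂∘β_*` with `Λ₁, Λ₂` additive `k`-valued on `H₁(X₀(M), ℤ)`. Gen 25's
K52 (`X4/OldShapeOfIhara`) and the Fitting projection (`X4/OldEigenPairOfIhara`) need a CHARACTER
`χ : 𝕋̃ → k` of the LEVEL-`M` Hecke ring with `χ(T_r) = θ̄(r)` — i.e. that `f`'s eigenvalues occur
mod `p` at level `M`, which is the CONCLUSION of level lowering, not an input. This file removes that
input: let `𝔫₀ = (p, T_r − θ(r) : r ∤ Mℓ) ⊆ 𝕋̃` (the level-`M` shadow of `𝔪_f`). EITHER `1 ∈ 𝔫₀`, and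
then `Φ` VANISHES on `H₁(X₀(Mℓ), ℤ)` (`apply_eq_zero_of_one_mem_idealSpan`: write
`1 = Σ bᵢ (T_{rᵢ} − θ(rᵢ)) + b p`, push each `bᵢ ∈ 𝕋̃` through the degeneracy maps by the tree's
`HeckeRing0.primeTo.exists_dualMap_degeneracyMap0_eq_smul`, and use `Φ∘T_r^∨ = θ̄(r)Φ`, `p = 0` in
`k`); OR `1 ∉ 𝔫₀`, and then `𝕋̃/𝔫₀ = 𝔽_p` and the quotient map IS the character
(`exists_ringHom_apply_T_eq_of_one_not_mem_idealSpan`: `ℤ → 𝕋̃/𝔫₀` is onto since every generator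
`T_r ≡ θ(r)`, and `ZMod.castHom` is injective on the non-trivial quotient of characteristic `p`).
The dichotomy `apply_eq_zero_or_exists_ringHom_apply_T_eq` is what V45's assembly consumes: in the
first case the certificate is trivial (`μ = 0`), in the second K52 + the Fitting projection apply.

## References

* K. A. Ribet, *On modular representations of `Gal(ℚ̄/ℚ)` arising from modular forms*, Invent. Math. 100 (1990), Thm. 1.1, §6. [cite: Ribet1990, Thm. 1.1]
* H. Darmon, F. Diamond, R. Taylor, *Fermat's Last Theorem* (1995), §4.1 p. 107, §4.3 pp. 119–120. [cite: DarmonDiamondTaylor1995, §4.3 (p. 119) and Lemma 4.30]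
* F. Diamond, J. Shurman, *A First Course in Modular Forms* (2005), Prop. 5.6.2. [cite: DiamondShurman2005, Prop. 5.6.2]
-/

noncomputable section

open scoped MatrixGroups ModularForm

open CongruenceSubgroup Finset Matrix

open Literature.NumberTheory.EllipticCurves Literature.NumberTheory.EllipticCurves.ModularForms
  Literature.NumberTheory.EllipticCurves.ModularForms.HidaCohomology

namespace Summit.BirchSwinnertonDyer.Rank1Residual.LevelLowering

/-! ### §1 Additive functions on the lattice; `𝕋̃`-equivariance of `α_*`, `β_*` -/

section Additive

variable {k : Type*} [CommRing k] {N : ℕ} [NeZero N]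

/-- An additive function on the lattice vanishes at `0`. [folklore] -/
theorem apply_zero_of_additive (Φ : Module.Dual ℂ (CuspForm (Gamma0 N) 2) → k)
    (hadd : ∀ x ∈ periodHomology N, ∀ y ∈ periodHomology N, Φ (x + y) = Φ x + Φ y) :
    Φ 0 = 0 := by
  have h := hadd 0 (zero_mem _) 0 (zero_mem _)
  rw [add_zero] at h
  linear_combination -h

/-- An additive function on the lattice is subtractive there. [folklore] -/
theorem apply_sub_of_additive (Φ : Module.Dual ℂ (CuspForm (Gamma0 N) 2) → k)
    (hadd : ∀ x ∈ periodHomology N, ∀ y ∈ periodHomology N, Φ (x + y) = Φ x + Φ y)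
    {x y : Module.Dual ℂ (CuspForm (Gamma0 N) 2)} (hx : x ∈ periodHomology N)
    (hy : y ∈ periodHomology N) : Φ (x - y) = Φ x - Φ y := by
  have h := hadd (x - y) (sub_mem hx hy) y hy
  rw [sub_add_cancel] at h
  linear_combination -h

/-- An additive function on the lattice is `ℤ`-homogeneous there. [folklore] -/
theorem apply_zsmul_of_additive (Φ : Module.Dual ℂ (CuspForm (Gamma0 N) 2) → k)
    (hadd : ∀ x ∈ periodHomology N, ∀ y ∈ periodHomology N, Φ (x + y) = Φ x + Φ y)
    {x : Module.Dual ℂ (CuspForm (Gamma0 N) 2)} (hx : x ∈ periodHomology N) (n : ℤ) :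
    Φ (n • x) = n * Φ x := by
  have h0 : Φ 0 = 0 := apply_zero_of_additive Φ hadd
  have hnat : ∀ m : ℕ, Φ ((m : ℤ) • x) = m * Φ x := by
    intro m
    induction m with
    | zero => simp [h0]
    | succ m ih =>
      have hmx : ((m : ℤ) • x) ∈ periodHomology N := (periodHomology N).zsmul_mem hx m
      rw [Nat.cast_succ, add_smul, one_smul, hadd _ hmx _ hx, ih]
      push_cast
      ring
  obtain ⟨m, rfl | rfl⟩ := Int.eq_nat_or_neg n
  · rw [Int.cast_natCast]; exact hnat m
  · have hmx : ((m : ℤ) • x) ∈ periodHomology N := (periodHomology N).zsmul_mem hx m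
    have h := hadd _ hmx _ ((periodHomology N).zsmul_mem hx (-(m : ℤ)))
    rw [← add_smul, add_neg_cancel, zero_smul, h0, hnat m] at h
    push_cast
    linear_combination -h

/-- `Φ((n : 𝕋_ℤ) • x) = n Φ(x)` on the lattice for an additive `Φ` (the integers of the Hecke ring
act as integers). [folklore] -/
theorem apply_intCast_smul_of_additive (Φ : Module.Dual ℂ (CuspForm (Gamma0 N) 2) → k)
    (hadd : ∀ x ∈ periodHomology N, ∀ y ∈ periodHomology N, Φ (x + y) = Φ x + Φ y)
    {x : Module.Dual ℂ (CuspForm (Gamma0 N) 2)} (hx : x ∈ periodHomology N) (n : ℤ) :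
    Φ ((n : HeckeRing0 N 2) • x) = n * Φ x := by
  rw [Int.cast_smul_eq_zsmul, apply_zsmul_of_additive Φ hadd hx n]

/-- **`α_{d,*}`, `β_*` are `T_r`-equivariant** (`r ∤ N` prime, `M d ∣ N`):
`α_{d,*}(T_r^{(N)} • z) = T_r^{(M)} • α_{d,*} z` on `S₂(Γ₀(N))^∨` (transpose of Diamond–Shurman
Prop. 5.6.2, the tree's `heckeT_degeneracyMap0`). [cite: DiamondShurman2005, Prop. 5.6.2] -/
theorem dualMap_degeneracyMap0_T_smul {M d : ℕ} [NeZero M] [NeZero d] (h : M * d ∣ N)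
    {r : ℕ} (hr : r.Prime) (hrN : ¬ r ∣ N) (z : Module.Dual ℂ (CuspForm (Gamma0 N) 2)) :
    (degeneracyMap0 M N d 2).dualMap (HeckeRing0.T N 2 r hr • z) =
      HeckeRing0.T M 2 r hr • (degeneracyMap0 M N d 2).dualMap z := by
  haveI : NeZero r := ⟨hr.ne_zero⟩
  ext g
  simp only [LinearMap.dualMap_apply, HeckeRing0.smul_dual_apply, HeckeRing0.toEnd_T,
    heckeT_degeneracyMap0 h hr hrN g]

end Additive

/-! ### §2 The dichotomy: `1 ∈ 𝔫₀` kills `Φ`; `1 ∉ 𝔫₀` gives the character -/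

section Dichotomy

variable {k : Type*} [CommRing k] {M : ℕ} [NeZero M] {ℓ : ℕ} [Fact ℓ.Prime] {p : ℕ}

/-- **If `1 ∈ 𝔫₀ = (p, T_r − θ(r) : r ∤ Mℓ prime) ⊆ 𝕋̃` then every `ℓ`-old `θ̄`-eigen-functional
vanishes on `H₁(X₀(Mℓ), ℤ)`.** Here `Φ` is `k`-valued on `S₂(Γ₀(Mℓ))^∨` with `(p : k) = 0`,
`Φ(T_r • z) = θ(r) Φ(z)` on the lattice for the primes `r ∤ Mℓ`, and `Φ = Λ₁∘α_* + Λ₂∘β_*` there with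
`Λ₁, Λ₂` additive on `H₁(X₀(M), ℤ)`. Proof: by induction over the ideal, the functional
`z ↦ Λ₁(s • α_* z) + Λ₂(s • β_* z)` vanishes on `H₁(X₀(Mℓ), ℤ)` for every `s ∈ 𝔫₀` — for a generator
`T_r − θ(r)` it is `Φ(T_r • z) − θ(r)Φ(z) = 0` (equivariance of `α_*, β_*`), for `p` it is `p·Φ(z) = 0`,
and multiples `b s` are handled by pushing `b ∈ 𝕋̃` through the degeneracy maps
(`HeckeRing0.primeTo.exists_dualMap_degeneracyMap0_eq_smul`); at `s = 1` it is `Φ` itself.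
[cite: DarmonDiamondTaylor1995, §4.3 (p. 119) and Lemma 4.30] [cite: DiamondShurman2005, Prop. 5.6.2] -/
theorem apply_eq_zero_of_one_mem_idealSpan (θ : ℕ → ℤ) (hp : (p : k) = 0)
    (Φ : Module.Dual ℂ (CuspForm (Gamma0 (M * ℓ)) 2) → k)
    (Λ₁ Λ₂ : Module.Dual ℂ (CuspForm (Gamma0 M) 2) → k)
    (hadd₁ : ∀ x ∈ periodHomology M, ∀ y ∈ periodHomology M, Λ₁ (x + y) = Λ₁ x + Λ₁ y)
    (hadd₂ : ∀ x ∈ periodHomology M, ∀ y ∈ periodHomology M, Λ₂ (x + y) = Λ₂ x + Λ₂ y)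
    (hΦT : ∀ (r : ℕ) (hr : r.Prime), ¬ r ∣ M * ℓ → ∀ z ∈ periodHomology (M * ℓ),
      Φ (HeckeRing0.T (M * ℓ) 2 r hr • z) = (θ r : k) * Φ z)
    (hΦ : ∀ z ∈ periodHomology (M * ℓ),
      Φ z = Λ₁ ((degeneracyMap0 M (M * ℓ) 1 2).dualMap z) +
        Λ₂ ((degeneracyMap0 M (M * ℓ) ℓ 2).dualMap z))
    (h1 : (1 : HeckeRing0.primeTo M 2 (M * ℓ)) ∈ Ideal.span
      ({(p : HeckeRing0.primeTo M 2 (M * ℓ))} ∪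
        {x | ∃ (r : ℕ) (hr : r.Prime) (hrS : ¬ r ∣ M * ℓ),
          x = HeckeRing0.primeTo.T M 2 (M * ℓ) hr hrS - (θ r : HeckeRing0.primeTo M 2 (M * ℓ))})) :
    ∀ z ∈ periodHomology (M * ℓ), Φ z = 0 := by
  have hℓ : ℓ.Prime := Fact.out
  haveI : NeZero ℓ := ⟨hℓ.ne_zero⟩
  have h1d : M * 1 ∣ M * ℓ := by rw [mul_one]; exact dvd_mul_right M ℓ
  have hℓd : M * ℓ ∣ M * ℓ := dvd_rfl
  have hαmem : ∀ z ∈ periodHomology (M * ℓ),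
      (degeneracyMap0 M (M * ℓ) 1 2).dualMap z ∈ periodHomology M :=
    fun z hz ↦ dualMap_degeneracyMap0_mem_periodHomology M (M * ℓ) 1 h1d hz
  have hβmem : ∀ z ∈ periodHomology (M * ℓ),
      (degeneracyMap0 M (M * ℓ) ℓ 2).dualMap z ∈ periodHomology M :=
    fun z hz ↦ dualMap_degeneracyMap0_mem_periodHomology M (M * ℓ) ℓ hℓd hz
  -- the vanishing statement, by induction over the ideal
  suffices key : ∀ s ∈ Ideal.span
      ({(p : HeckeRing0.primeTo M 2 (M * ℓ))} ∪
        {x | ∃ (r : ℕ) (hr : r.Prime) (hrS : ¬ r ∣ M * ℓ),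
          x = HeckeRing0.primeTo.T M 2 (M * ℓ) hr hrS - (θ r : HeckeRing0.primeTo M 2 (M * ℓ))}),
      ∀ z ∈ periodHomology (M * ℓ),
        Λ₁ ((s : HeckeRing0 M 2) • (degeneracyMap0 M (M * ℓ) 1 2).dualMap z) +
          Λ₂ ((s : HeckeRing0 M 2) • (degeneracyMap0 M (M * ℓ) ℓ 2).dualMap z) = 0 by
    intro z hz
    have h := key 1 h1 z hz
    rwa [OneMemClass.coe_one, one_smul, one_smul, ← hΦ z hz] at h
  intro s hs
  induction hs using Submodule.span_induction with
  | mem x hx =>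
    intro z hz
    rcases hx with hx | ⟨r, hr, hrS, rfl⟩
    · -- `x = p`: `Λᵢ(p • y) = p Λᵢ(y) = 0`
      rw [Set.mem_singleton_iff] at hx
      subst hx
      have ep : ((p : HeckeRing0.primeTo M 2 (M * ℓ)) : HeckeRing0 M 2) = ((p : ℤ) : HeckeRing0 M 2) := by
        rw [SubringClass.coe_natCast, Int.cast_natCast]
      rw [ep, apply_intCast_smul_of_additive Λ₁ hadd₁ (hαmem z hz),
        apply_intCast_smul_of_additive Λ₂ hadd₂ (hβmem z hz), Int.cast_natCast, hp, zero_mul,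
        zero_mul, add_zero]
    · -- `x = T_r − θ(r)`: `Φ(T_r • z) − θ(r) Φ(z) = 0`
      have hTz : HeckeRing0.T (M * ℓ) 2 r hr • z ∈ periodHomology (M * ℓ) :=
        HeckeRing0.smul_mem_periodHomology _ _ hz
      have eT : ((HeckeRing0.primeTo.T M 2 (M * ℓ) hr hrS -
          (θ r : HeckeRing0.primeTo M 2 (M * ℓ)) : HeckeRing0.primeTo M 2 (M * ℓ)) : HeckeRing0 M 2) =
          HeckeRing0.T M 2 r hr - ((θ r : ℤ) : HeckeRing0 M 2) := by
        rw [AddSubgroupClass.coe_sub, HeckeRing0.primeTo.coe_T, SubringClass.coe_intCast]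
      rw [eT, sub_smul, sub_smul,
        apply_sub_of_additive Λ₁ hadd₁ (HeckeRing0.smul_mem_periodHomology _ _ (hαmem z hz))
          (HeckeRing0.smul_mem_periodHomology _ _ (hαmem z hz)),
        apply_sub_of_additive Λ₂ hadd₂ (HeckeRing0.smul_mem_periodHomology _ _ (hβmem z hz))
          (HeckeRing0.smul_mem_periodHomology _ _ (hβmem z hz)),
        apply_intCast_smul_of_additive Λ₁ hadd₁ (hαmem z hz),
        apply_intCast_smul_of_additive Λ₂ hadd₂ (hβmem z hz),
        ← dualMap_degeneracyMap0_T_smul h1d hr hrS z, ← dualMap_degeneracyMap0_T_smul hℓd hr hrS z]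
      have h := hΦT r hr hrS z hz
      rw [hΦ _ hTz, hΦ z hz] at h
      linear_combination h
  | zero =>
    intro z hz
    rw [ZeroMemClass.coe_zero, zero_smul, zero_smul, apply_zero_of_additive Λ₁ hadd₁,
      apply_zero_of_additive Λ₂ hadd₂, add_zero]
  | add x y _ _ hx hy =>
    intro z hz
    rw [AddMemClass.coe_add, add_smul, add_smul,
      hadd₁ _ (HeckeRing0.smul_mem_periodHomology _ _ (hαmem z hz)) _
        (HeckeRing0.smul_mem_periodHomology _ _ (hαmem z hz)),
      hadd₂ _ (HeckeRing0.smul_mem_periodHomology _ _ (hβmem z hz)) _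
        (HeckeRing0.smul_mem_periodHomology _ _ (hβmem z hz))]
    have h₁ := hx z hz
    have h₂ := hy z hz
    linear_combination h₁ + h₂
  | smul a x _ hx =>
    intro z hz
    -- push `a ∈ 𝕋̃` through the degeneracy maps
    obtain ⟨z', hz', hz'eq⟩ :=
      HeckeRing0.primeTo.exists_dualMap_degeneracyMap0_eq_smul (M := M) (N := M * ℓ) a.2 hz
    rw [smul_eq_mul, MulMemClass.coe_mul, mul_comm, mul_smul, mul_smul, ← hz'eq 1 h1d,
      ← hz'eq ℓ hℓd]
    exact hx z' hz'

omit [Fact ℓ.Prime] in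
/-- **If `1 ∉ 𝔫₀ = (p, T_r − θ(r) : r ∤ Mℓ prime)` then `θ̄` IS a character of the level-`M` Hecke
ring `𝕋̃`**: there is a ring homomorphism `χ : 𝕋̃ → 𝔽_p` with `χ(T_r) = θ(r) mod p` for every prime
`r ∤ Mℓ`. Proof: `𝕋̃/𝔫₀` is non-trivial of characteristic `p`; `ℤ → 𝕋̃/𝔫₀` is onto because `𝕋̃`
is generated by the `T_r` and `T_r ≡ θ(r)`; so `ZMod.castHom : 𝔽_p → 𝕋̃/𝔫₀` is a ring
isomorphism, and `χ` is its inverse composed with the quotient map. (The character by which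
`𝕋̃` acts on Ribet's level-lowered form read mod `𝔭` — here obtained WITHOUT a level-lowered form.)
[cite: DarmonDiamondTaylor1995, §4.3 (p. 119) and Lemma 4.30] [cite: Ribet1990, Thm. 1.1] -/
theorem exists_ringHom_apply_T_eq_of_one_not_mem_idealSpan [Fact p.Prime] (θ : ℕ → ℤ)
    (h1 : (1 : HeckeRing0.primeTo M 2 (M * ℓ)) ∉ Ideal.span
      ({(p : HeckeRing0.primeTo M 2 (M * ℓ))} ∪
        {x | ∃ (r : ℕ) (hr : r.Prime) (hrS : ¬ r ∣ M * ℓ),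
          x = HeckeRing0.primeTo.T M 2 (M * ℓ) hr hrS - (θ r : HeckeRing0.primeTo M 2 (M * ℓ))})) :
    ∃ χ : HeckeRing0.primeTo M 2 (M * ℓ) →+* ZMod p,
      ∀ (r : ℕ) (hr : r.Prime) (hrS : ¬ r ∣ M * ℓ),
        χ (HeckeRing0.primeTo.T M 2 (M * ℓ) hr hrS) = θ r := by
  classical
  have hpp : p.Prime := Fact.out
  set 𝔫 : Ideal (HeckeRing0.primeTo M 2 (M * ℓ)) := Ideal.span
      ({(p : HeckeRing0.primeTo M 2 (M * ℓ))} ∪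
        {x | ∃ (r : ℕ) (hr : r.Prime) (hrS : ¬ r ∣ M * ℓ),
          x = HeckeRing0.primeTo.T M 2 (M * ℓ) hr hrS - (θ r : HeckeRing0.primeTo M 2 (M * ℓ))})
    with h𝔫
  have hne : 𝔫 ≠ ⊤ := fun h ↦ h1 (h ▸ Submodule.mem_top)
  haveI : Nontrivial (HeckeRing0.primeTo M 2 (M * ℓ) ⧸ 𝔫) := Ideal.Quotient.nontrivial_iff.mpr hne
  -- the generators reduce to integers
  have hT : ∀ (r : ℕ) (hr : r.Prime) (hrS : ¬ r ∣ M * ℓ),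
      Ideal.Quotient.mk 𝔫 (HeckeRing0.primeTo.T M 2 (M * ℓ) hr hrS) =
        ((θ r : ℤ) : HeckeRing0.primeTo M 2 (M * ℓ) ⧸ 𝔫) := by
    intro r hr hrS
    rw [← map_intCast (Ideal.Quotient.mk 𝔫), Ideal.Quotient.eq]
    exact Ideal.subset_span (Set.mem_union_right _ ⟨r, hr, hrS, rfl⟩)
  -- characteristic `p`
  have hp0 : ((p : ℕ) : HeckeRing0.primeTo M 2 (M * ℓ) ⧸ 𝔫) = 0 := by
    rw [← map_natCast (Ideal.Quotient.mk 𝔫), Ideal.Quotient.eq_zero_iff_mem]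
    exact Ideal.subset_span (Set.mem_union_left _ (Set.mem_singleton _))
  haveI : CharP (HeckeRing0.primeTo M 2 (M * ℓ) ⧸ 𝔫) p := (CharP.charP_iff_prime_eq_zero hpp).mpr hp0
  -- every class is an integer
  have hgen : ∀ s : HeckeRing0.primeTo M 2 (M * ℓ), ∃ n : ℤ,
      Ideal.Quotient.mk 𝔫 s = (n : HeckeRing0.primeTo M 2 (M * ℓ) ⧸ 𝔫) := by
    rintro ⟨s, hs⟩
    change s ∈ Algebra.adjoin ℤ _ at hs
    induction hs using Algebra.adjoin_induction with
    | mem x hx =>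
      obtain ⟨r, hr, hrS, rfl⟩ := hx
      exact ⟨θ r, hT r hr hrS⟩
    | algebraMap n =>
      refine ⟨n, ?_⟩
      rw [← map_intCast (Ideal.Quotient.mk 𝔫)]
      congr 1
    | add x y hx' hy' hx hy =>
      obtain ⟨m, hm⟩ := hx
      obtain ⟨n, hn⟩ := hy
      refine ⟨m + n, ?_⟩
      rw [show (⟨x + y, Subalgebra.add_mem _ hx' hy'⟩ : HeckeRing0.primeTo M 2 (M * ℓ)) =
          ⟨x, hx'⟩ + ⟨y, hy'⟩ from rfl, (Ideal.Quotient.mk 𝔫).map_add, hm, hn, Int.cast_add]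
    | mul x y hx' hy' hx hy =>
      obtain ⟨m, hm⟩ := hx
      obtain ⟨n, hn⟩ := hy
      refine ⟨m * n, ?_⟩
      rw [show (⟨x * y, Subalgebra.mul_mem _ hx' hy'⟩ : HeckeRing0.primeTo M 2 (M * ℓ)) =
          ⟨x, hx'⟩ * ⟨y, hy'⟩ from rfl, (Ideal.Quotient.mk 𝔫).map_mul, hm, hn, Int.cast_mul]
  -- `ZMod.castHom : 𝔽_p → 𝕋̃/𝔫₀` is bijective
  have hsurj : Function.Surjective (ZMod.castHom (dvd_refl p) (HeckeRing0.primeTo M 2 (M * ℓ) ⧸ 𝔫)) := by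
    intro y
    obtain ⟨s, rfl⟩ := Ideal.Quotient.mk_surjective y
    obtain ⟨n, hn⟩ := hgen s
    exact ⟨n, by rw [map_intCast, hn]⟩
  set e := RingEquiv.ofBijective (ZMod.castHom (dvd_refl p) (HeckeRing0.primeTo M 2 (M * ℓ) ⧸ 𝔫))
    ⟨ZMod.castHom_injective _, hsurj⟩ with he
  refine ⟨e.symm.toRingHom.comp (Ideal.Quotient.mk 𝔫), fun r hr hrS ↦ ?_⟩
  rw [RingHom.comp_apply, hT r hr hrS, RingEquiv.toRingHom_eq_coe, RingEquiv.coe_toRingHom,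
    RingEquiv.symm_apply_eq, he, RingEquiv.ofBijective_apply, map_intCast]

/-- **THE DICHOTOMY.** For an `ℓ`-old `θ̄`-eigen-functional `Φ = Λ₁∘α_* + Λ₂∘β_*` on
`H₁(X₀(Mℓ), ℤ)` (`Λᵢ` additive on `H₁(X₀(M), ℤ)`, `(p : k) = 0`): EITHER `Φ` vanishes on
`H₁(X₀(Mℓ), ℤ)`, OR the system `θ̄` is a character `χ : 𝕋̃ → 𝔽_p` of the LEVEL-`M` prime-to-`Mℓ`
Hecke ring (`χ(T_r) = θ(r)`, `r ∤ Mℓ`). The second alternative is the mod-`p` level-lowering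
statement for the eigen-system (Ribet 1990 Thm. 1.1's conclusion), here DERIVED from the `ℓ`-old
decomposition. [cite: Ribet1990, Thm. 1.1] [cite: DarmonDiamondTaylor1995, §4.3 (p. 119) and Lemma 4.30] -/
theorem apply_eq_zero_or_exists_ringHom_apply_T_eq [Fact p.Prime] (θ : ℕ → ℤ) (hp : (p : k) = 0)
    (Φ : Module.Dual ℂ (CuspForm (Gamma0 (M * ℓ)) 2) → k)
    (Λ₁ Λ₂ : Module.Dual ℂ (CuspForm (Gamma0 M) 2) → k)
    (hadd₁ : ∀ x ∈ periodHomology M, ∀ y ∈ periodHomology M, Λ₁ (x + y) = Λ₁ x + Λ₁ y)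
    (hadd₂ : ∀ x ∈ periodHomology M, ∀ y ∈ periodHomology M, Λ₂ (x + y) = Λ₂ x + Λ₂ y)
    (hΦT : ∀ (r : ℕ) (hr : r.Prime), ¬ r ∣ M * ℓ → ∀ z ∈ periodHomology (M * ℓ),
      Φ (HeckeRing0.T (M * ℓ) 2 r hr • z) = (θ r : k) * Φ z)
    (hΦ : ∀ z ∈ periodHomology (M * ℓ),
      Φ z = Λ₁ ((degeneracyMap0 M (M * ℓ) 1 2).dualMap z) +
        Λ₂ ((degeneracyMap0 M (M * ℓ) ℓ 2).dualMap z)) :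
    (∀ z ∈ periodHomology (M * ℓ), Φ z = 0) ∨
      ∃ χ : HeckeRing0.primeTo M 2 (M * ℓ) →+* ZMod p,
        ∀ (r : ℕ) (hr : r.Prime) (hrS : ¬ r ∣ M * ℓ),
          χ (HeckeRing0.primeTo.T M 2 (M * ℓ) hr hrS) = θ r := by
  by_cases h1 : (1 : HeckeRing0.primeTo M 2 (M * ℓ)) ∈ Ideal.span
      ({(p : HeckeRing0.primeTo M 2 (M * ℓ))} ∪
        {x | ∃ (r : ℕ) (hr : r.Prime) (hrS : ¬ r ∣ M * ℓ),
          x = HeckeRing0.primeTo.T M 2 (M * ℓ) hr hrS - (θ r : HeckeRing0.primeTo M 2 (M * ℓ))})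
  · exact Or.inl (apply_eq_zero_of_one_mem_idealSpan θ hp Φ Λ₁ Λ₂ hadd₁ hadd₂ hΦT hΦ h1)
  · exact Or.inr (exists_ringHom_apply_T_eq_of_one_not_mem_idealSpan θ h1)

end Dichotomy

end Summit.BirchSwinnertonDyer.Rank1Residual.LevelLowering

end
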